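import Literature.AnabelianGeometry.EtaleTheta.RootsOfUnityGaloisPrimePower
import Literature.AnabelianGeometry.EtaleTheta.ZHatPadicCharacter
import HarnessLib

/-!
# The `p`-adic cyclotomic character `χ_p : G_{ℚ_p} → ℤ_p^×` is SURJECTIVE (classical; proof-only)

J.-P. Serre, *Local Fields*, IV §4 Prop. 17 / Prop. 18: `Gal(ℚ_p(ζ_{p^∞})/ℚ_p) ≅ ℤ_p^×` via the cyclotomic character
[cite: SerreLocalFields1979, IV §4 Prop 17]; L. Ribes, P. Zalesskii, *Profinite Groups*, Thm. 2.7.1 (`Ẑ^× ↠ ℤ_p^×`)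
[cite: RibesZalesskii2010, Thm 2.7.1]; S. Mochizuki, [EtTh] §1 p. 12 "`Δ_Θ (≅ Ẑ(1))`" [cite: MochizukiEtTh2009, §1 p.12].

abc-iut cell, layer L2, seat abc-iut-w5-d091 (gen 5); χ-lineage (R78 F3), F3 addendum 5.  PROOF-ONLY (no definition, no
instance, no named fact).  Composes THE cyclotomic character `chi p : G_{ℚ_p} →* Aut(Ẑ)` of F3
(`SettingModelCyclotomicCharacter`) with abc-iut-w4-d024's `p`-adic character `ZHatLevel.padicChar(Units) p : Aut(Ẑ) →* ℤ_p(^×)`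
(`ZHatPadicCharacter`, glued from the level characters `χ_{pᵏ}`), and proves that the composite hits EVERY `p`-adic unit:

* `toZModPow_padicChar_chi` — `χ_p(σ) mod pᵏ = χ_{pᵏ}(σ)` (bookkeeping);
* `isClosed_setOf_levelChar_chi_eq` — the fibres `{σ | χ_{pᵏ}(σ) = c}` are CLOSED (and open: F3) in `G_{ℚ_p}`;
* **`exists_padicChar_chi_eq (a : ℤ_[p]ˣ) : ∃ σ : G_{ℚ_p}, χ_p(σ) = a`** — by COMPACTNESS of `G_{ℚ_p}`: the closed sets
  `Z_k = {σ | χ_{p^{k+1}}(σ) = a mod p^{k+1}}` are non-empty (F3 addendum 4 `exists_levelChar_chi_eq`: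
  `Gal(ℚ_p(ζ_{pᵏ})/ℚ_p) = (ℤ/pᵏ)^×`) and decreasing, so they have a common point, whose `p`-adic character has the same
  reductions as `a` at every level (`PadicInt.ext_of_toZModPow`);
* **`padicCharUnits_comp_chi_surjective : Function.Surjective ((ZHatLevel.padicCharUnits p).comp (chi p))`** —
  `χ_p : G_{ℚ_p} ↠ ℤ_p^×`; so at the χ-twisted models of the R78 cluster (`Δ_Θ ≅ Ẑ(χ)`, abc-iut-L6-d6's
  `deltaThetaCoordχ_chi`) the Galois action on the `p`-part of `Δ_Θ` runs through ALL of `ℤ_p^× = Aut(ℤ_p)`.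
Classical; nothing of [EtTh] is asserted; no side is taken on [IUTchIII] Cor. 3.12; a model is consistency evidence only.
-/

noncomputable section

open CategoryTheory ProfiniteGrp ProfiniteGrp.ProfiniteCompletion

namespace Literature.AnabelianGeometry.EtaleTheta.SettingModel

open Literature.AnabelianGeometry.SemiGraphs

variable (p : ℕ) [hp : Fact p.Prime]

/-! ### Bookkeeping: reductions and fibres -/

/-- `χ_p(σ) mod pᵏ = χ_{pᵏ}(σ)` (abc-iut-w4-d024's `toZModPow_padicChar` at `χ(σ)`). [cite: RibesZalesskii2010, Thm 2.7.1] -/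
theorem toZModPow_padicChar_chi (σ : GQp p) (k : ℕ) :
    PadicInt.toZModPow k (ZHatLevel.padicChar p (chi p σ)) =
      (ZHatLevel.levelChar (ZHatLevel.ppow p k) (chi p σ) : ZMod (p ^ k)) :=
  ZHatLevel.toZModPow_padicChar p (chi p σ) k

/-- Level compatibility along `χ`: for `k ≤ n`, `χ_{pᵏ}(σ) = χ_{pⁿ}(σ) mod pᵏ`. [cite: RibesZalesskii2010, Thm 2.7.1] -/
theorem castHom_levelChar_chi_ppow (σ : GQp p) {k n : ℕ} (hkn : k ≤ n) :
    ZMod.castHom (pow_dvd_pow p hkn) (ZMod (p ^ k)) (ZHatLevel.levelChar (ZHatLevel.ppow p n) (chi p σ)) =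
      ZHatLevel.levelChar (ZHatLevel.ppow p k) (chi p σ) :=
  (ZHatLevel.LevelFamily.ofAut (chi p σ)).compat (ZHatLevel.ppow p k) (ZHatLevel.ppow p n) (pow_dvd_pow p hkn)

/-- The fibres `{σ | χ_N(σ) = c}` are CLOSED in `G_{ℚ_p}` (F3: `σ ↦ χ_N(σ)` is locally constant).
[cite: NeukirchANT1999, Ch. IV §1] -/
theorem isClosed_setOf_levelChar_chi_eq (N : ℕ+) (c : ZMod N) :
    IsClosed {σ : GQp p | ZHatLevel.levelChar N (chi p σ) = c} :=
  (isLocallyConstant_levelChar_chi p N).isClosed_fiber c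

/-- … and clopen. [cite: NeukirchANT1999, Ch. IV §1] -/
theorem isClopen_setOf_levelChar_chi_eq (N : ℕ+) (c : ZMod N) :
    IsClopen {σ : GQp p | ZHatLevel.levelChar N (chi p σ) = c} :=
  (isLocallyConstant_levelChar_chi p N).isClopen_fiber c

/-! ### Surjectivity of `χ_p : G_{ℚ_p} → ℤ_p^×` -/

/-- **Every `p`-adic unit is a value of the `p`-adic cyclotomic character on `G_{ℚ_p}`**: for `a ∈ ℤ_p^×` some
`σ ∈ G_{ℚ_p}` has `χ_p(σ) = a` — compactness of `G_{ℚ_p}` applied to the non-empty (F3 addendum 4) closed decreasing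
sets `{σ | χ_{p^{k+1}}(σ) = a mod p^{k+1}}`. [cite: SerreLocalFields1979, IV §4 Prop 17] -/
theorem exists_padicChar_chi_eq (a : ℤ_[p]ˣ) : ∃ σ : GQp p, ZHatLevel.padicChar p (chi p σ) = (a : ℤ_[p]) := by
  -- `G_{ℚ_p}` is compact: `ℚ̄_p/ℚ_p` is Galois (cf. abc-iut-L2-t1's `SettingModel.compactSpace_GQp`)
  haveI : IsGalois ℚ_[p] (PadicAlgCl p) := {}
  -- the closed sets `Z k = {σ | χ_{p^{k+1}}(σ) = a mod p^{k+1}}`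
  let Z : ℕ → Set (GQp p) := fun k =>
    {σ | ZHatLevel.levelChar (ZHatLevel.ppow p (k + 1)) (chi p σ) = PadicInt.toZModPow (k + 1) (a : ℤ_[p])}
  have hZcl : ∀ k, IsClosed (Z k) := fun k =>
    isClosed_setOf_levelChar_chi_eq p (ZHatLevel.ppow p (k + 1)) _
  have hZne : ∀ k, (Z k).Nonempty := fun k => by
    have hu : IsUnit (PadicInt.toZModPow (k + 1) (a : ℤ_[p])) := a.isUnit.map _
    obtain ⟨σ, hσ⟩ := exists_levelChar_chi_eq p k.succ_pos hu.unit
    exact ⟨σ, hσ.trans hu.unit_spec⟩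
  have hZmono : ∀ k, Z (k + 1) ⊆ Z k := fun k σ hσ => by
    have hc := castHom_levelChar_chi_ppow p σ (Nat.le_succ (k + 1))
    rw [show ZHatLevel.levelChar (ZHatLevel.ppow p (k + 1 + 1)) (chi p σ) =
        PadicInt.toZModPow (k + 1 + 1) (a : ℤ_[p]) from hσ, ZMod.castHom_apply,
      PadicInt.cast_toZModPow (k + 1) (k + 1 + 1) (Nat.le_succ _)] at hc
    exact hc.symm
  obtain ⟨σ, hσ⟩ := IsCompact.nonempty_iInter_of_sequence_nonempty_isCompact_isClosed Z hZmono hZne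
    (hZcl 0).isCompact hZcl
  refine ⟨σ, PadicInt.ext_of_toZModPow.mp fun n => ?_⟩
  have hall : ∀ k, PadicInt.toZModPow (k + 1) (ZHatLevel.padicChar p (chi p σ)) =
      PadicInt.toZModPow (k + 1) (a : ℤ_[p]) := fun k => by
    rw [toZModPow_padicChar_chi]
    exact Set.mem_iInter.mp hσ k
  cases n with
  | zero =>
    rw [← PadicInt.cast_toZModPow 0 1 zero_le_one, ← PadicInt.cast_toZModPow 0 1 zero_le_one (a : ℤ_[p]), hall 0]
  | succ k => exact hall k

/-- Units form: some `σ` has `padicCharUnits p (χ σ) = a`. [cite: SerreLocalFields1979, IV §4 Prop 17] -/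
theorem exists_padicCharUnits_chi_eq (a : ℤ_[p]ˣ) : ∃ σ : GQp p, ZHatLevel.padicCharUnits p (chi p σ) = a := by
  obtain ⟨σ, hσ⟩ := exists_padicChar_chi_eq p a
  exact ⟨σ, Units.ext (by rw [ZHatLevel.coe_padicCharUnits]; exact hσ)⟩

/-- **`χ_p : G_{ℚ_p} ↠ ℤ_p^×` — the `p`-adic cyclotomic character of `G_{ℚ_p}` (F3's `χ` followed by `Ẑ^× → ℤ_p^×`) is
SURJECTIVE.** [cite: SerreLocalFields1979, IV §4 Prop 17] -/
theorem padicCharUnits_comp_chi_surjective :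
    Function.Surjective ((ZHatLevel.padicCharUnits p).comp (chi p)) := fun a => by
  obtain ⟨σ, hσ⟩ := exists_padicCharUnits_chi_eq p a
  exact ⟨σ, by rw [MonoidHom.comp_apply]; exact hσ⟩

/-- Range form: `χ_p(G_{ℚ_p}) = ℤ_p^×`. [cite: SerreLocalFields1979, IV §4 Prop 17] -/
theorem range_padicCharUnits_comp_chi : ((ZHatLevel.padicCharUnits p).comp (chi p)).range = ⊤ :=
  MonoidHom.range_eq_top.mpr (padicCharUnits_comp_chi_surjective p)

/-- `ℤ_p`-valued range form: the values `χ_p(σ) ∈ ℤ_p`, `σ ∈ G_{ℚ_p}`, are EXACTLY the units of `ℤ_p`.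
[cite: SerreLocalFields1979, IV §4 Prop 17] -/
theorem range_padicChar_chi :
    Set.range (fun σ : GQp p => ZHatLevel.padicChar p (chi p σ)) = {a : ℤ_[p] | IsUnit a} :=
  Set.ext fun a =>
    ⟨fun ⟨σ, hσ⟩ => hσ ▸ ZHatLevel.isUnit_padicChar p (chi p σ),
     fun ha => by
       obtain ⟨σ, hσ⟩ := exists_padicChar_chi_eq p (IsUnit.unit ha)
       exact ⟨σ, hσ.trans (IsUnit.unit_spec ha)⟩⟩

end Literature.AnabelianGeometry.EtaleTheta.SettingModel

end
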